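import Summits.BirchSwinnertonDyer.BirchSwinnertonDyer.Theorems.ByReductionTypeAtTwoMultUpperHalf
import Summits.BirchSwinnertonDyer.BirchSwinnertonDyer.Theses.ByReductionTypeAtTwo
import Summits.BirchSwinnertonDyer.Rank1Residual.X5.TwoAdicTargetsMultKatoInt
import Summits.BirchSwinnertonDyer.Rank1Residual.X5.TwoAdicTargetsEndStateClosed
import Summits.BirchSwinnertonDyer.BirchSwinnertonDyer.Theorems.ByReductionTypeAtTwoMultUpperHalfDefs
import HarnessLib

/-!
# Route `ByReductionTypeAtTwo`, crux `MultUpperHalfAtTwo` (item stmt-BirchSwinnertonDyer-19922), second file: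
# the crux follows from ONE standard statement — the INTEGRAL (Néron-normalised) Kato divisibility at `2`
# at the `X₀(N)`-optimal curve of each class — with no `μ`, no period and no `λ` input

HONEST FRAMING (cell `bsd-2adic`, run/shared/lean/pub/bsd-2adic/, seat `bsd-2adic-mult-2`, D-0074 row
(A)): research route; nothing is booked; BSD is not proved by any of this. PARTITION: X5@2 mult (K4ᵐ,
RESIDUAL-MAP B1·O1; 1 976 book230 classes) × p = 2 — types-the-object-of (the open content of item 19922 as
ONE divisibility in `Λ = ℤ₂⟦T⟧` per class); closes none.

Companion of `ByReductionTypeAtTwoMultUpperHalf.lean` (p418902). There the upper half was reached on the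
«`μ = 0` road» (Kato `⊗ℚ` + `μ(X) = 0` + `0 ≤ ord₂ ϖ` at one member). Here the three are replaced by the
single statement they serve to prove — Kato's divisibility `char_Λ X(E/ℚ_∞) ∣ ϖ·L₂(f)` IN `Λ` (non-split:
`ι g = ϖ · L`; split: `ι(T · g) = ϖ · L`, the trivial zero charged to the local condition at `2`), i.e.
Kato 2004 Thm. 17.4 (3) / 17.13 at the prime `p = 2 ∣ N` that the printed theorem excludes — and it is
required at the `X₀(N)`-OPTIMAL member only (Cassels moves the half; every class has an optimal member by
modularity, `X12.exists_isIsogenous_optimal`):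

* §1 `missingUpperBoundAt_two_mult_of_integralKato` — per member, both signs: PRINT {A235 `h41ns` / A236
  `h41sp`, modularity, GZK} + MEMO {Greenberg–Stevens at a split `2`, guarded} + the integral divisibility
  at THIS member ⇒ `MissingUpperBoundAt W 2` (the tree's per-pair consumers
  `O1.upperBound_two_{nonsplit,split}_of_divisibilityRat` at slack `k = 0`, `ϖ′ = ϖ`).
* §2 **`multUpperHalfAtTwo_of_integralKatoAtOptimal`** — the FULLY-QUALIFIED route decl
  `…Theses.ByReductionTypeAtTwo.MultUpperHalfAtTwo` from PRINT {`h41ns`, `h41sp`, `hmod`, `hGZK`, `hCassels`}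
  + MEMO {`hGS`} + ONE hypothesis `hKint`: the integral Kato divisibility at every `X₀(N)`-optimal curve
  (globally minimal, non-CM, analytic rank `0`, multiplicative at `2`, lattice-optimal datum at level `N`).
  `hKint` is the Kato half of the `2`-adic main conjecture at a multiplicative `2`, integrally, restricted
  to optimal curves: believed TRUE (so the theorem is not vacuous), NOT in print (Kato 17.4 (3) assumes
  `p ≠ 2`; Skinner 2016 / Wuthrich 2014 Cor. 19 keep `p` odd), and implied on the «`μ(E₀) = 0`» classes by
  the refereed memo PROOF-MULT (`⊗ℚ`) through p418902's road. This is the sharpest honest reading of what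
  item 19922 still needs.
* §3 `integralKato_of_katoRat_of_mu_eq_zero_of_period` — the `μ = 0` road (Kato `⊗ℚ` + `μ = 0` + `0 ≤ ord₂ ϖ`
  at a member) PROVES `hKint` at that member (the tree's integrality and `μ = 0`-upgrade lemmas): §2 ⊇ the
  road of p418902.

References: [Kato2004Asterisque] Thm. 17.4, 17.13; [Kobayashi2006DocMath] Cor. 4.2; [GreenbergLNM1716]
§4 pp. 112–113; [MazurTateTeitelbaum1986Invent] §I.10–I.15; [Cassels1965ArithmeticVIII];
[Miller2011LMS] Def. 1.1; [Cesnavicius2018] Thm. 1.2 (not used here: no period input is needed).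
-/

set_option autoImplicit false
set_option linter.dupNamespace false

noncomputable section

open scoped Classical MatrixGroups ModularForm

open CongruenceSubgroup WeierstrassCurve Literature.NumberTheory.EllipticCurves
  Literature.NumberTheory.EllipticCurves.ModularForms
  Literature.NumberTheory.EllipticCurves.Greenberg1999
  Literature.NumberTheory.EllipticCurves.Rank1Residual
  Literature.NumberTheory.EllipticCurves.Rank1Residual.Typed
  Summit.BirchSwinnertonDyer.Rank1Residual.X5

namespace Summit.BirchSwinnertonDyer.BirchSwinnertonDyer.Theorems

/-! ## §1 Per member: the upper half from the integral divisibility at this member -/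

/-- **`MissingUpperBoundAt W 2` at a multiplicative `2`, analytic rank `0`, from Kato's divisibility IN
`Λ` at THIS member (both signs; no `μ`, no period input).** For the newform `f` of `W` at level `N_W`,
every cyclotomic `ℤ₂`-extension datum `(κ, γ)`, every dual datum `D` of `Sel_{2^∞}(E/ℚ_∞)` and every
period ratio `ϖ` (`ϖ · Ω_W = Ω⁺_f`): non-split (`hKn`) — for every multiplicative `2`-adic `L`-function `L`
of `f`, `X` is torsion and `ι g = ϖ · L` for some `g ∈ char_Λ X`; split (`hKs`) — for every split `L`,
`X` is torsion and `ι(T · g) = ϖ · L` for some `g ∈ char_Λ X`. With PRINT {A235 `h41ns` / A236 `h41sp`,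
modularity `hmod`, GZK `hGZK`} and, at a split `2`, Greenberg–Stevens (`hGS`, MEMO PROOF-GS2, guarded;
turned into the `κ₁`-certificate by `O1.kappaOne_of_greenbergStevens`), the tree's per-pair consumers
`O1.upperBound_two_nonsplit_of_divisibilityRat` / `O1.upperBound_two_split_of_divisibilityRat` at slack
`k = 0` give the upper half. Composition; nothing asserted. [cite: Kato2004Asterisque, Thm. 17.4 (p. 273) and 17.13 (shape; p = 2 ∣ N not in print)]
[cite: GreenbergLNM1716, §4 pp. 112–113] [cite: MazurTateTeitelbaum1986Invent, §I.10 and §I.14–15]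
[cite: Miller2011LMS, Def. 1.1] -/
theorem missingUpperBoundAt_two_mult_of_integralKato (W : WeierstrassCurve ℚ) [W.IsElliptic]
    [W.IsGloballyMinimal]
    (h41ns : thm41Analogue_charValue_rankZero_numberField_anyPrime)
    (h41sp : thm41Analogue_charValue_rankZero_split_baseChange_anyPrime)
    (hmod : nonempty_modularParametrizationData)
    (hGZK : rank_eq_analyticRank_of_analyticRank_le_one)
    (hGS : W.HasSplitMultiplicativeReductionAtPrime 2 → greenberg_stevens (W := W) (p := 2))
    (hKn : ¬ W.HasSplitMultiplicativeReductionAtPrime 2 →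
      ∀ (κ : ZpExtension ℚ 2) (γ : Field.absoluteGaloisGroup ℚ), κ.IsCyclotomic → κ.IsTopGenerator γ →
      IsCyclotomicVariable 2 γ →
      ∀ [NeZero (W.conductorNorm ℤ)] (f : CuspForm (Gamma0 (W.conductorNorm ℤ)) 2), IsNewformOf W f →
      ∀ ϖ : ℚ, (ϖ : ℝ) * W.realPeriodRat = plusPeriod f →
      ∀ L : PowerSeries ℚ_[2], IsMultPAdicLFunctionOf f 2 (-1) L → ∀ D : W.SelmerDualData κ γ,
        D.IsTorsion ∧ ∃ g ∈ D.charIdeal,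
          iwasawaToPowerSeries 2 g = PowerSeries.C (ϖ : ℚ_[2]) * L)
    (hKs : W.HasSplitMultiplicativeReductionAtPrime 2 →
      ∀ (κ : ZpExtension ℚ 2) (γ : Field.absoluteGaloisGroup ℚ), κ.IsCyclotomic → κ.IsTopGenerator γ →
      IsCyclotomicVariable 2 γ →
      ∀ [NeZero (W.conductorNorm ℤ)] (f : CuspForm (Gamma0 (W.conductorNorm ℤ)) 2), IsNewformOf W f →
      ∀ ϖ : ℚ, (ϖ : ℝ) * W.realPeriodRat = plusPeriod f →
      ∀ L : PowerSeries ℚ_[2], IsSplitMultPAdicLFunctionOf f 2 L → ∀ D : W.SelmerDualData κ γ,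
        D.IsTorsion ∧ ∃ g ∈ D.charIdeal,
          iwasawaToPowerSeries 2 (PowerSeries.X * g) = PowerSeries.C (ϖ : ℚ_[2]) * L)
    (hr : W.analyticRank = 0) (hmult : Mult W 2) : MissingUpperBoundAt W 2 := by
  haveI : NeZero (W.conductorNorm ℤ) := ⟨(W.conductorNorm_pos_holds).ne'⟩
  obtain ⟨Dm⟩ := hmod W
  have hf : IsNewformOf W Dm.f := Dm.isNewformOf
  have hL : W.entireLFunction 1 ≠ 0 :=
    (W.analyticRank_eq_zero_iff_holds hf.hasEntireLFunction).mp hr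
  obtain ⟨ϖ, hϖpos, hϖeq, -⟩ := Dm.exists_rat_mul_realPeriodRat_eq_plusPeriod
  obtain ⟨κ, hκ, γ, hγ, hγ'⟩ := exists_isCyclotomic_isTopGenerator_isCyclotomicVariable_holds 2
  obtain ⟨D⟩ := W.nonempty_selmerDualData_holds κ γ hγ
  by_cases hsp : W.HasSplitMultiplicativeReductionAtPrime 2
  · obtain ⟨L, hLf⟩ := exists_isSplitMultPAdicLFunctionOf hsp hf
    obtain ⟨Dq⟩ := (nonempty_tateParameterData_iff_holds (W := W) (p := 2)).mpr hsp
    have hlog : padicLog 2 Dq.q ≠ 0 :=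
      Dq.padicLog_q_ne_zero Literature.NumberTheory.Transcendental.MahlerManinPadic_holds
    have hdiv := hKs hsp κ γ hκ hγ hγ' Dm.f hf ϖ hϖeq L hLf D
    obtain ⟨q, hq, hle⟩ := O1.upperBound_two_split_of_divisibilityRat W
      (O1.twoAdicEulerCharRankZeroSplitMult_zero_of_greenberg W h41sp) hGZK hmult hsp hL hκ hγ hγ' hf
      Dq hlog (O1.kappaOne_of_greenbergStevens W (hGS hsp) hr hf hLf Dq) D ϖ hϖeq hϖpos.ne' 0
      (by simp) hdiv
    exact ⟨q, hq, by simpa using hle⟩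
  · obtain ⟨L, hLf⟩ := exists_isMultPAdicLFunctionOf_neg_one_of_nonsplit hf hmult hsp
    have hdiv := hKn hsp κ γ hκ hγ hγ' Dm.f hf ϖ hϖeq L hLf D
    obtain ⟨q, hq, hle⟩ := O1.upperBound_two_nonsplit_of_divisibilityRat W
      (O1.twoAdicEulerCharRankZeroNonsplitMult_zero_of_greenberg W h41ns) hGZK hmult hsp hL hκ hγ hγ'
      hf hLf D ϖ hϖeq hϖpos.ne' 0 (by simp) hdiv
    exact ⟨q, hq, by simpa using hle⟩

/-! ## §2 The crux decl from the integral divisibility at the optimal curves -/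

/-- **Item stmt-BirchSwinnertonDyer-19922 `MultUpperHalfAtTwo` from ONE statement (conditional;
FULLY-QUALIFIED type).** PRINT {A235 `h41ns`, A236 `h41sp`, modularity `hmod`, GZK `hGZK`, Cassels
`hCassels`} + MEMO {Greenberg–Stevens at a split `2` `hGS` (PROOF-GS2, RC-4)} + `hKint` — Kato's
divisibility IN `Λ` (Néron-normalised: `ι g = ϖ · L`, resp. `ι(T · g) = ϖ · L` at a split `2`, `g ∈
char_Λ X(E₀/ℚ_∞)`, `X` torsion) for the newform at level `N` of every `X₀(N)`-OPTIMAL curve `E₀` (globally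
minimal `W₀`, non-CM, analytic rank `0`, multiplicative at `2`, with a lattice-optimal parametrisation
datum `Λ_{W₀} = c₀Λ_f`) — imply `MultUpperHalfAtTwo`: every class has an optimal member (modularity,
`X12.exists_isIsogenous_optimal`), §1 gives the upper half there, Cassels (`X12.missingUpperBoundAt_of_isIsogenous`)
moves it to every member. `hKint` is the Kato half of the cyclotomic main conjecture at a multiplicative
`2` read integrally at optimal curves — believed, NOT in print (Kato 2004 Thm. 17.4 (3) assumes `p ≠ 2`;
at `p ∣ N` only `⊗ℚ` via 17.13 / Kobayashi 2006) — and on the classes with `μ(X(E₀/ℚ_∞)) = 0` it follows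
from the refereed `⊗ℚ` memo (p418902's road). [cite: Kato2004Asterisque, Thm. 17.4 (p. 273) and 17.13 (pp. 279–280)]
[cite: Kobayashi2006DocMath, Cor. 4.2] [cite: Cassels1965ArithmeticVIII] [cite: Miller2011LMS, §1 and Def. 1.1] -/
theorem multUpperHalfAtTwo_of_integralKatoAtOptimal
    (h41ns : thm41Analogue_charValue_rankZero_numberField_anyPrime)
    (h41sp : thm41Analogue_charValue_rankZero_split_baseChange_anyPrime)
    (hmod : nonempty_modularParametrizationData)
    (hGZK : rank_eq_analyticRank_of_analyticRank_le_one)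
    (hCassels : bsdRHS_eq_of_isIsogenous)
    (hGS : ∀ (W : WeierstrassCurve ℚ) [W.IsElliptic] [W.IsGloballyMinimal],
      W.HasSplitMultiplicativeReductionAtPrime 2 → greenberg_stevens (W := W) (p := 2))
    (hKint : ∀ (W₀ : WeierstrassCurve ℚ) [W₀.IsElliptic] [W₀.IsGloballyMinimal]
      [NeZero (W₀.conductorNorm ℤ)], ¬ W₀.HasCM → W₀.analyticRank = 0 → Mult W₀ 2 →
      ∀ D₀ : ModularParametrizationData W₀ (W₀.conductorNorm ℤ), Zhai2021.IsOptimalDatum W₀ D₀ →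
      ∀ (κ : ZpExtension ℚ 2) (γ : Field.absoluteGaloisGroup ℚ), κ.IsCyclotomic → κ.IsTopGenerator γ →
      IsCyclotomicVariable 2 γ →
      ∀ (f : CuspForm (Gamma0 (W₀.conductorNorm ℤ)) 2), IsNewformOf W₀ f →
      ∀ ϖ : ℚ, (ϖ : ℝ) * W₀.realPeriodRat = plusPeriod f → ∀ D : W₀.SelmerDualData κ γ,
        D.IsTorsion ∧
        (¬ W₀.HasSplitMultiplicativeReductionAtPrime 2 →
          ∀ L : PowerSeries ℚ_[2], IsMultPAdicLFunctionOf f 2 (-1) L →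
            ∃ g ∈ D.charIdeal, iwasawaToPowerSeries 2 g = PowerSeries.C (ϖ : ℚ_[2]) * L) ∧
        (W₀.HasSplitMultiplicativeReductionAtPrime 2 →
          ∀ L : PowerSeries ℚ_[2], IsSplitMultPAdicLFunctionOf f 2 L →
            ∃ g ∈ D.charIdeal,
              iwasawaToPowerSeries 2 (PowerSeries.X * g) = PowerSeries.C (ϖ : ℚ_[2]) * L)) :
    Summit.BirchSwinnertonDyer.BirchSwinnertonDyer.Theses.ByReductionTypeAtTwo.MultUpperHalfAtTwo := by
  unfold Summit.BirchSwinnertonDyer.BirchSwinnertonDyer.Theses.ByReductionTypeAtTwo.MultUpperHalfAtTwo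
  intro W _ _ _ hr hmult
  have hnf : exists_isNewformOf := exists_isNewformOf_of_nonempty_modularParametrizationData hmod
  -- the optimal member of the class and its class data
  obtain ⟨W₀, hE₀, hM₀, hN₀, D₀, hiso, -, hopt⟩ :=
    Summit.BirchSwinnertonDyer.Rank1Residual.X12.exists_isIsogenous_optimal hnf W
  have hmult₀ : Mult W₀ 2 :=
    Summit.BirchSwinnertonDyer.Rank1Residual.X2.IsogenyQuotientLine.hasMultiplicativeReductionAtPrime_of_isIsogenous
      hiso hmult
  have hr₀ : W₀.analyticRank = 0 := (analyticRank_eq_of_isIsogenous' hiso).symm.trans hr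
  have hcm₀ : ¬ W₀.HasCM := fun h ↦ Rank1Residual.not_mult_of_hasCM W₀ h 2 hmult₀
  have hK₀ := hKint W₀ hcm₀ hr₀ hmult₀ D₀ hopt
  -- the upper half at `W₀` (§1; the level-`N_{W₀}` instance is the one fixed above)
  have hU₀ : MissingUpperBoundAt W₀ 2 := by
    refine missingUpperBoundAt_two_mult_of_integralKato W₀ h41ns h41sp hmod hGZK (hGS W₀) ?_ ?_ hr₀ hmult₀
    · intro hns κ γ hκ hγ hγ' _ f hf ϖ hϖ L hLf D
      obtain ⟨hX, hn, -⟩ := hK₀ κ γ hκ hγ hγ' f hf ϖ hϖ D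
      exact ⟨hX, hn hns L hLf⟩
    · intro hsp κ γ hκ hγ hγ' _ f hf ϖ hϖ L hLf D
      obtain ⟨hX, -, hs⟩ := hK₀ κ γ hκ hγ hγ' f hf ϖ hϖ D
      exact ⟨hX, hs hsp L hLf⟩
  -- Cassels
  obtain ⟨Dm⟩ := hmod W₀
  have hlead₀ : W₀.leadingLCoeff ≠ 0 :=
    W₀.leadingLCoeff_ne_zero_holds Dm.isNewformOf.hasEntireLFunction
  have hfin₀ : Finite W₀.sha := (hGZK W₀ (by rw [hr₀]; exact zero_le_one)).2
  exact Summit.BirchSwinnertonDyer.Rank1Residual.X12.missingUpperBoundAt_of_isIsogenous hCassels hiso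
    hfin₀ hlead₀ hU₀

/-! ## §3 The road of p418902 supplies the integral divisibility -/

/-- **The `μ = 0` road IS a proof of the integral divisibility at that member.** At a member `W`
multiplicative at `2` with Kato `⊗ℚ` (`hKato`, MEMO PROOF-MULT RC-2), `μ(X(W/ℚ_∞)) = 0` for the cyclotomic
data (`hμ`) and `0 ≤ ord₂ ϖ` for the period ratios of the newform at level `N_W` (`hper₀`), the Néron-normalised
`2`-adic `L`-function is integral (`exists_iwasawaToPowerSeries_eq_C_mul_of_isMultPAdicLFunctionOf_neg_one_two`,
`O1.exists_integral_mul_of_isSplitMultPAdicLFunctionOf_two_of_padicValRat_nonneg`) and the `μ = 0` upgrade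
(`O1.charIdeal_dvd_of_divisibility_of_mu_eq_zero`, `O1.exists_mem_charIdeal_X_mul_of_mu_eq_zero`) puts it in
`char_Λ X`: the hypothesis `hKint` of §2 holds at `W`. So §2 ⊇ p418902's road; the converse direction is the
open content of item 19922. [cite: GreenbergVatsal2000, p. 4 (μ = 0 upgrade, shape)]
[cite: Kato2004Asterisque, Thm. 17.4 (1)(2) and 17.13 (shape)] [cite: MazurTateTeitelbaum1986Invent, §I.10 and §I.12] -/
theorem integralKato_of_katoRat_of_mu_eq_zero_of_period (W : WeierstrassCurve ℚ) [W.IsElliptic]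
    [W.IsGloballyMinimal] (hKato : O1.KatoMultiplicativeDivisibilityRat W 2)
    (hμ : ∀ (κ : ZpExtension ℚ 2) (γ : Field.absoluteGaloisGroup ℚ), κ.IsCyclotomic →
      κ.IsTopGenerator γ → IsCyclotomicVariable 2 γ → ∀ D : W.SelmerDualData κ γ, D.mu = 0)
    (hper₀ : ∀ [NeZero (W.conductorNorm ℤ)] (f : CuspForm (Gamma0 (W.conductorNorm ℤ)) 2),
      IsNewformOf W f → ∀ ϖ : ℚ, (ϖ : ℝ) * W.realPeriodRat = plusPeriod f → 0 ≤ padicValRat 2 ϖ)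
    (hmult : Mult W 2) (κ : ZpExtension ℚ 2) (γ : Field.absoluteGaloisGroup ℚ) (hκ : κ.IsCyclotomic)
    (hγ : κ.IsTopGenerator γ) (hγ' : IsCyclotomicVariable 2 γ) [NeZero (W.conductorNorm ℤ)]
    (f : CuspForm (Gamma0 (W.conductorNorm ℤ)) 2) (hf : IsNewformOf W f) (ϖ : ℚ)
    (hϖ : (ϖ : ℝ) * W.realPeriodRat = plusPeriod f) (D : W.SelmerDualData κ γ) :
    D.IsTorsion ∧
    (¬ W.HasSplitMultiplicativeReductionAtPrime 2 →
      ∀ L : PowerSeries ℚ_[2], IsMultPAdicLFunctionOf f 2 (-1) L →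
        ∃ g ∈ D.charIdeal, iwasawaToPowerSeries 2 g = PowerSeries.C (ϖ : ℚ_[2]) * L) ∧
    (W.HasSplitMultiplicativeReductionAtPrime 2 →
      ∀ L : PowerSeries ℚ_[2], IsSplitMultPAdicLFunctionOf f 2 L →
        ∃ g ∈ D.charIdeal,
          iwasawaToPowerSeries 2 (PowerSeries.X * g) = PowerSeries.C (ϖ : ℚ_[2]) * L) := by
  obtain ⟨hX, -, -⟩ := hKato κ γ hκ hγ hγ' hmult f hf D
  refine ⟨hX, fun hns L hLf ↦ ?_, fun hsp L hLf ↦ ?_⟩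
  · obtain ⟨hX', n, g, hg, hι⟩ :=
      O1.katoDivisibilityAtTwoNonsplitMultRat_of_multRat W hKato f L κ γ hκ hγ hγ' hmult hns hf hLf D
    obtain ⟨L₀, hL₀⟩ := exists_iwasawaToPowerSeries_eq_C_mul_of_isMultPAdicLFunctionOf_neg_one_two hf
      hmult hns (hper₀ f hf ϖ hϖ) hLf
    exact ⟨L₀, O1.charIdeal_dvd_of_divisibility_of_mu_eq_zero W 2 hγ D hX' (hμ κ γ hκ hγ hγ' D)
      ⟨n, g, hg, hι⟩ hL₀, hL₀⟩
  · obtain ⟨hX', n, g, hg, hι⟩ :=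
      O1.katoDivisibilityAtTwoSplitMultRat_of_multRat W hKato f L κ γ hκ hγ hγ' hmult hsp hf hLf D
    obtain ⟨L₀, hL₀⟩ :=
      O1.exists_integral_mul_of_isSplitMultPAdicLFunctionOf_two_of_padicValRat_nonneg W hsp hf hLf
        (hper₀ f hf ϖ hϖ)
    exact O1.exists_mem_charIdeal_X_mul_of_mu_eq_zero W hγ D hX' (hμ κ γ hκ hγ hγ' D)
      hLf.constantCoeff_eq_zero ⟨n, g, hg, hι⟩ hL₀

/-! ## §4 (appended, seat GEN 2) The integral-Kato door T-KATO2-NSMULT IS `hKint` at a non-split surjective member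
NEW INPUT since §1–§3: kernel p419632 `X5/TwoAdicTargetsMultKatoInt.lean` displays `O1.KatoDivisibilityAtTwoNonsplitMultInt W`
(memo PROOF-KATO2MULT Thm. A, referee pending): Kato's divisibility IN `Λ` with the `2`-power part for `W` non-split
multiplicative at `2`, `ρ_{E,2^∞}` surjective, `Δ_W < 0`. It discharges `hKint` of §2 at such curves (§4), hence the leaf
`IntegralKatoAtOptimalMultTwo` on its locus (§5, §6); the `∀`-reductions through the door: `…MultUpperHalfKatoInt.lean`, `…Parity.lean`. -/

/-- **T-KATO2-NSMULT discharges the integral Kato leaf at a non-split, `2`-adically surjective member of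
negative discriminant.** For a globally minimal `W` multiplicative and NON-SPLIT at `2` with
`ρ_{E,2^∞}(G_ℚ) = GL₂(ℤ₂)` (`O1.TwoAdicSurjective W`) and `Δ_W < 0`, the door
`O1.KatoDivisibilityAtTwoNonsplitMultInt W` (memo PROOF-KATO2MULT Thm. A, referee pending) gives, for
every cyclotomic datum `(κ, γ)`, every newform `f` of `W` at any level, every period ratio `ϖ`
(`ϖ·Ω_W = Ω⁺_f`) and every dual datum `D`: `X` is torsion, and `ϖ·L ∈ ι(char_Λ X)` for every `2`-adic
`L`-function `L` of `f` at the non-split prime (the split clause is vacuous). The only extra input is the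
period datum `0 ≤ ord₂ ϖ`, which is PRINT here: surjective ⇒ `E[2]` irreducible
(`O1.irr_two_of_twoAdicSurjective`) ⇒ `ord₂ ϖ = 0` (`padicValRat_periodRatio_eq_zero_of_irr_two`,
Česnavičius 2018 Thm. 1.2 `hC`), so that `ϖ·L ∈ ι Λ`
(`exists_iwasawaToPowerSeries_eq_C_mul_of_isMultPAdicLFunctionOf_neg_one_two`). This is exactly the
binder `hKint` of `multUpperHalfAtTwo_of_integralKatoAtOptimal` (p420150) at `W`. Composition; nothing
asserted. [cite: Kato2004Asterisque, Prop. 17.11–Lemma 17.12 and Thm. 17.13 (pp. 277–280; shape, p = 2 ∣ N not in print)]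
[cite: Cesnavicius2018, Thm. 1.2] [cite: Serre1972, §4 (surjective ⇒ irreducible)] -/
theorem integralKato_of_katoIntNonsplit
    (hC : cesnavicius_not_two_dvd_maninConstant_of_two_dvd_level) (W : WeierstrassCurve ℚ)
    [W.IsElliptic] [W.IsGloballyMinimal] (hKint : O1.KatoDivisibilityAtTwoNonsplitMultInt W)
    (hmult : Mult W 2) (hns : ¬ W.HasSplitMultiplicativeReductionAtPrime 2)
    (him : O1.TwoAdicSurjective W) (hΔ : W.Δ < 0)
    (κ : ZpExtension ℚ 2) (γ : Field.absoluteGaloisGroup ℚ) (hκ : κ.IsCyclotomic)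
    (hγ : κ.IsTopGenerator γ) (hγ' : IsCyclotomicVariable 2 γ) {N : ℕ} [NeZero N]
    (f : CuspForm (Gamma0 N) 2) (hf : IsNewformOf W f) (ϖ : ℚ)
    (hϖ : (ϖ : ℝ) * W.realPeriodRat = plusPeriod f) (D : W.SelmerDualData κ γ) :
    D.IsTorsion ∧
    (¬ W.HasSplitMultiplicativeReductionAtPrime 2 →
      ∀ L : PowerSeries ℚ_[2], IsMultPAdicLFunctionOf f 2 (-1) L →
        ∃ g ∈ D.charIdeal, iwasawaToPowerSeries 2 g = PowerSeries.C (ϖ : ℚ_[2]) * L) ∧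
    (W.HasSplitMultiplicativeReductionAtPrime 2 →
      ∀ L : PowerSeries ℚ_[2], IsSplitMultPAdicLFunctionOf f 2 L →
        ∃ g ∈ D.charIdeal,
          iwasawaToPowerSeries 2 (PowerSeries.X * g) = PowerSeries.C (ϖ : ℚ_[2]) * L) := by
  have hirr : Irr W 2 := O1.irr_two_of_twoAdicSurjective W him
  have hper : 0 ≤ padicValRat 2 ϖ :=
    (padicValRat_periodRatio_eq_zero_of_irr_two hC W hmult hirr f hf ϖ hϖ).ge
  -- the integral divisibility for every `L` at the non-split prime
  have hdiv : ∀ L : PowerSeries ℚ_[2], IsMultPAdicLFunctionOf f 2 (-1) L →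
      D.IsTorsion ∧ ∃ g ∈ D.charIdeal,
        iwasawaToPowerSeries 2 g = PowerSeries.C (ϖ : ℚ_[2]) * L := by
    intro L hLf
    obtain ⟨L₀, hL₀⟩ :=
      exists_iwasawaToPowerSeries_eq_C_mul_of_isMultPAdicLFunctionOf_neg_one_two hf hmult hns hper hLf
    obtain ⟨hX, hmem⟩ := hKint hmult hns him hΔ f hf L hLf κ γ hκ hγ hγ' D ϖ hϖ L₀ hL₀
    exact ⟨hX, L₀, hmem, hL₀⟩
  obtain ⟨L, hLf⟩ := exists_isMultPAdicLFunctionOf_neg_one_of_nonsplit hf hmult hns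
  exact ⟨(hdiv L hLf).1, fun _ L' hL' ↦ (hdiv L' hL').2, fun hsp ↦ absurd hsp hns⟩

/-! ## §5 (appended) The leaf `IntegralKatoAtOptimalMultTwo` on the three roads -/

/-- **The same, through the single leaf of p420150: T-KATO2-NSMULT proves `IntegralKatoAtOptimalMultTwo`
on its locus.** With MEMO {`hKato` Kato `⊗ℚ`, `hKint` the door for every curve} and PRINT {`h514`, `hC`},
the integral Kato divisibility at an `X₀(N)`-optimal curve (the leaf `MultUpperHalvesAtTwo.IntegralKatoAtOptimalMultTwo`,
binder shape of p420150 verbatim) holds as soon as the optimal curve is on one of the three roads —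
`μ = 0` (p420150 `integralKato_of_katoRat_of_mu_eq_zero_of_period`), a Prop-5.14 datum (`μ = 0` is then
PRINT), or the door's locus (§1) — so the leaf's open content is exactly the residual of
`multUpperHalfAtTwo_of_katoInt_of_optimalMuZero_of_offRoads` read one level down (integral divisibility
instead of the upper half). Stated per optimal curve `W₀`. Composition; nothing asserted.
[cite: Kato2004Asterisque, Thm. 17.4 (3) (p. 273; p ≠ 2 in print) and 17.13] [cite: GreenbergLNM1716, Prop. 5.14 (p. 121)]
[cite: Cesnavicius2018, Thm. 1.2] -/
theorem integralKatoAtOptimal_of_roads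
    (hKato : ∀ (W : WeierstrassCurve ℚ) [W.IsElliptic] [W.IsGloballyMinimal],
      ¬ W.HasCM → Mult W 2 → O1.KatoMultiplicativeDivisibilityRat W 2)
    (h514 : prop514_isTorsion_mu_eq_zero_two)
    (hC : cesnavicius_not_two_dvd_maninConstant_of_two_dvd_level)
    (hKint : ∀ (W : WeierstrassCurve ℚ) [W.IsElliptic] [W.IsGloballyMinimal],
      O1.KatoDivisibilityAtTwoNonsplitMultInt W)
    (W₀ : WeierstrassCurve ℚ) [W₀.IsElliptic] [W₀.IsGloballyMinimal] [NeZero (W₀.conductorNorm ℤ)]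
    (hcm₀ : ¬ W₀.HasCM) (hmult₀ : Mult W₀ 2)
    (D₀ : ModularParametrizationData W₀ (W₀.conductorNorm ℤ)) (hopt : Zhai2021.IsOptimalDatum W₀ D₀)
    (hroad : (∀ (κ : ZpExtension ℚ 2) (γ : Field.absoluteGaloisGroup ℚ), κ.IsCyclotomic →
          κ.IsTopGenerator γ → IsCyclotomicVariable 2 γ → ∀ D : W₀.SelmerDualData κ γ, D.mu = 0) ∨
      (∃ x y : ℚ, W₀.toAffine.Equation x y ∧ 2 * y + W₀.a₁ * x + W₀.a₃ = 0 ∧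
          ((TwoTorsionRamifiedAtTwo x ∧ ¬ TwoTorsionOdd W₀ x) ∨
            (TwoTorsionOdd W₀ x ∧ ¬ TwoTorsionRamifiedAtTwo x))) ∨
      (¬ W₀.HasSplitMultiplicativeReductionAtPrime 2 ∧ O1.TwoAdicSurjective W₀ ∧ W₀.Δ < 0))
    (κ : ZpExtension ℚ 2) (γ : Field.absoluteGaloisGroup ℚ) (hκ : κ.IsCyclotomic)
    (hγ : κ.IsTopGenerator γ) (hγ' : IsCyclotomicVariable 2 γ)
    (f : CuspForm (Gamma0 (W₀.conductorNorm ℤ)) 2) (hf : IsNewformOf W₀ f) (ϖ : ℚ)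
    (hϖ : (ϖ : ℝ) * W₀.realPeriodRat = plusPeriod f) (D : W₀.SelmerDualData κ γ) :
    D.IsTorsion ∧
    (¬ W₀.HasSplitMultiplicativeReductionAtPrime 2 →
      ∀ L : PowerSeries ℚ_[2], IsMultPAdicLFunctionOf f 2 (-1) L →
        ∃ g ∈ D.charIdeal, iwasawaToPowerSeries 2 g = PowerSeries.C (ϖ : ℚ_[2]) * L) ∧
    (W₀.HasSplitMultiplicativeReductionAtPrime 2 →
      ∀ L : PowerSeries ℚ_[2], IsSplitMultPAdicLFunctionOf f 2 L →
        ∃ g ∈ D.charIdeal,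
          iwasawaToPowerSeries 2 (PowerSeries.X * g) = PowerSeries.C (ϖ : ℚ_[2]) * L) := by
  -- the period datum at the optimal curve is PRINT
  have hper₀ : ∀ [NeZero (W₀.conductorNorm ℤ)] (f : CuspForm (Gamma0 (W₀.conductorNorm ℤ)) 2),
      IsNewformOf W₀ f → ∀ ϖ : ℚ, (ϖ : ℝ) * W₀.realPeriodRat = plusPeriod f → 0 ≤ padicValRat 2 ϖ :=
    fun f hf ϖ hϖ ↦ (padicValRat_periodRatio_eq_zero_of_isOptimalDatum hC W₀ hmult₀ D₀ hopt f hf ϖ hϖ).ge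
  rcases hroad with hμ | ⟨x, y, hP, h2, hΦ⟩ | ⟨hns, him, hΔ⟩
  · exact integralKato_of_katoRat_of_mu_eq_zero_of_period W₀ (hKato W₀ hcm₀ hmult₀) hμ hper₀ hmult₀ κ γ
      hκ hγ hγ' f hf ϖ hϖ D
  · exact integralKato_of_katoRat_of_mu_eq_zero_of_period W₀ (hKato W₀ hcm₀ hmult₀)
      (fun _ _ hκ hγ _ D ↦ (h514.of_mult W₀ hmult₀ hP h2 hΦ hκ hγ D).2) hper₀ hmult₀ κ γ hκ hγ hγ' f hf
      ϖ hϖ D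
  · exact integralKato_of_katoIntNonsplit hC W₀ (hKint W₀) hmult₀ hns him hΔ κ γ hκ hγ hγ' f hf ϖ hϖ D

/-! ## §6 (appended) The leaf `IntegralKatoAtOptimalMultTwo` from the three roads + an integral-level residual -/
/-- **The leaf `MultUpperHalvesAtTwo.IntegralKatoAtOptimalMultTwo` (p420550) from the three roads and ONE
residual hypothesis at the integral level.** MEMO {`hKato` Kato `⊗ℚ` (RC-2), `hKint` T-KATO2-NSMULT for every
curve (referee pending)} + PRINT {`h514`, `hC`} + `hres`: the integral Kato divisibility (binder shape of p420150
verbatim) at the `X₀(N)`-optimal curves OFF the three roads (no `μ = 0`, no Prop-5.14 datum, not non-split ∧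
surjective ∧ `Δ < 0`) ⟹ the leaf (on the roads §5, off them `hres`): the planner may split the leaf C3 =
`IntegralKatoAtOptimalMultTwo` one level down exactly as the upper half splits in `…MultUpperHalfKatoInt.lean`.
[cite: Kato2004Asterisque, Thm. 17.4 (3) (p. 273; p ≠ 2 in print) and 17.13] [cite: GreenbergLNM1716, Prop. 5.14 (p. 121)] -/
theorem integralKatoAtOptimalMultTwo_of_roads_of_residual
    (hKato : ∀ (W : WeierstrassCurve ℚ) [W.IsElliptic] [W.IsGloballyMinimal],
      ¬ W.HasCM → Mult W 2 → O1.KatoMultiplicativeDivisibilityRat W 2)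
    (h514 : prop514_isTorsion_mu_eq_zero_two)
    (hC : cesnavicius_not_two_dvd_maninConstant_of_two_dvd_level)
    (hKint : ∀ (W : WeierstrassCurve ℚ) [W.IsElliptic] [W.IsGloballyMinimal],
      O1.KatoDivisibilityAtTwoNonsplitMultInt W)
    (hres : ∀ (W₀ : WeierstrassCurve ℚ) [W₀.IsElliptic] [W₀.IsGloballyMinimal]
      [NeZero (W₀.conductorNorm ℤ)], ¬ W₀.HasCM → W₀.analyticRank = 0 → Mult W₀ 2 →
      ∀ D₀ : ModularParametrizationData W₀ (W₀.conductorNorm ℤ), Zhai2021.IsOptimalDatum W₀ D₀ →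
      (¬ ∀ (κ : ZpExtension ℚ 2) (γ : Field.absoluteGaloisGroup ℚ), κ.IsCyclotomic →
          κ.IsTopGenerator γ → IsCyclotomicVariable 2 γ → ∀ D : W₀.SelmerDualData κ γ, D.mu = 0) →
      (¬ ∃ x y : ℚ, W₀.toAffine.Equation x y ∧ 2 * y + W₀.a₁ * x + W₀.a₃ = 0 ∧
          ((TwoTorsionRamifiedAtTwo x ∧ ¬ TwoTorsionOdd W₀ x) ∨
            (TwoTorsionOdd W₀ x ∧ ¬ TwoTorsionRamifiedAtTwo x))) →
      ¬ (¬ W₀.HasSplitMultiplicativeReductionAtPrime 2 ∧ O1.TwoAdicSurjective W₀ ∧ W₀.Δ < 0) →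
      ∀ (κ : ZpExtension ℚ 2) (γ : Field.absoluteGaloisGroup ℚ), κ.IsCyclotomic → κ.IsTopGenerator γ →
      IsCyclotomicVariable 2 γ →
      ∀ (f : CuspForm (Gamma0 (W₀.conductorNorm ℤ)) 2), IsNewformOf W₀ f →
      ∀ ϖ : ℚ, (ϖ : ℝ) * W₀.realPeriodRat = plusPeriod f → ∀ D : W₀.SelmerDualData κ γ,
        D.IsTorsion ∧
        (¬ W₀.HasSplitMultiplicativeReductionAtPrime 2 →
          ∀ L : PowerSeries ℚ_[2], IsMultPAdicLFunctionOf f 2 (-1) L →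
            ∃ g ∈ D.charIdeal, iwasawaToPowerSeries 2 g = PowerSeries.C (ϖ : ℚ_[2]) * L) ∧
        (W₀.HasSplitMultiplicativeReductionAtPrime 2 →
          ∀ L : PowerSeries ℚ_[2], IsSplitMultPAdicLFunctionOf f 2 L →
            ∃ g ∈ D.charIdeal,
              iwasawaToPowerSeries 2 (PowerSeries.X * g) = PowerSeries.C (ϖ : ℚ_[2]) * L)) :
    MultUpperHalvesAtTwo.IntegralKatoAtOptimalMultTwo := by
  intro W₀ _ _ _ hcm₀ hr₀ hmult₀ D₀ hopt κ γ hκ hγ hγ' f hf ϖ hϖ D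
  by_cases hμ₀ : ∀ (κ : ZpExtension ℚ 2) (γ : Field.absoluteGaloisGroup ℚ), κ.IsCyclotomic →
      κ.IsTopGenerator γ → IsCyclotomicVariable 2 γ → ∀ D : W₀.SelmerDualData κ γ, D.mu = 0
  · exact integralKatoAtOptimal_of_roads hKato h514 hC hKint W₀ hcm₀ hmult₀ D₀ hopt (Or.inl hμ₀) κ γ hκ hγ hγ'
      f hf ϖ hϖ D
  by_cases h514₀ : ∃ x y : ℚ, W₀.toAffine.Equation x y ∧ 2 * y + W₀.a₁ * x + W₀.a₃ = 0 ∧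
      ((TwoTorsionRamifiedAtTwo x ∧ ¬ TwoTorsionOdd W₀ x) ∨
        (TwoTorsionOdd W₀ x ∧ ¬ TwoTorsionRamifiedAtTwo x))
  · exact integralKatoAtOptimal_of_roads hKato h514 hC hKint W₀ hcm₀ hmult₀ D₀ hopt (Or.inr (Or.inl h514₀)) κ
      γ hκ hγ hγ' f hf ϖ hϖ D
  by_cases hdoor : ¬ W₀.HasSplitMultiplicativeReductionAtPrime 2 ∧ O1.TwoAdicSurjective W₀ ∧ W₀.Δ < 0
  · exact integralKatoAtOptimal_of_roads hKato h514 hC hKint W₀ hcm₀ hmult₀ D₀ hopt (Or.inr (Or.inr hdoor)) κ γ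
      hκ hγ hγ' f hf ϖ hϖ D
  exact hres W₀ hcm₀ hr₀ hmult₀ D₀ hopt hμ₀ h514₀ hdoor κ γ hκ hγ hγ' f hf ϖ hϖ D

end Summit.BirchSwinnertonDyer.BirchSwinnertonDyer.Theorems

end
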